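import Literature.NumberTheory.GaloisRepresentations.ContinuousCorestrictionTransfer
import HarnessLib

/-!
# Corestriction on `H¹` of an ABELIAN group with trivial coefficients: `cor[f](g) = f(g ^ (G : H))`

Topic `NumberTheory/GaloisRepresentations`; namespace `Literature.NumberTheory.GaloisRepresentations`.
Theorems only (no definition, no named fact).  For a commutative topological group `G`, an open
subgroup `H` of finite index `n` and trivial coefficients, the transfer `Ver : G → H` is `g ↦ gⁿ`
(Mathlib `MonoidHom.transfer_eq_pow`), so by `ContinuousCorestrictionTransfer.lean` the
corestriction of a continuous character `f` of `H` is the continuous character `g ↦ f(gⁿ)` of `G`: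

* `transfer_eq_apply_pow_index` — `Ver_φ(g) = φ(gⁿ)` for `G` commutative;
* `exists_contOneCocycles_apply_eq_apply_pow` — `g ↦ f(gⁿ)` is a continuous `1`-cocycle of `G`;
* **`cores_oneCocycleClass_eq_of_comm` — `cor [f] = [g ↦ f(gⁿ)]`** in `H¹(G, A)`
  (Serre, *Local Fields* VII §8: "if `G` is abelian, `Ver` is induced by `x ↦ xⁿ`"); e.g. for
  `G ≅ Ẑ` and `H` the subgroup of index `n`.

Honest framing: classical; nothing here bears on abc or takes a side on [IUTchIII] Cor. 3.12.

## References
* J.-P. Serre, *Local Fields* (1979), VII §8. [SerreLocalFields1979]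
-/

noncomputable section

open CategoryTheory Function

universe u v

namespace Literature.NumberTheory.GaloisRepresentations

open _root_.ContinuousCohomology

section CommTransfer

variable {G : Type v} [CommGroup G] {H : Subgroup G} [H.FiniteIndex] {M : Type*} [CommGroup M]

/-- **`Ver(g) = φ(g ^ (G : H))` for a commutative group** (Mathlib `MonoidHom.transfer_eq_pow`, whose
centrality hypothesis is automatic). [cite: SerreLocalFields1979, VII §8] -/
theorem transfer_eq_apply_pow_index (φ : H →* M) (g : G) :
    MonoidHom.transfer φ g = φ ⟨g ^ H.index, H.pow_index_mem g⟩ := by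
  rw [MonoidHom.transfer_eq_pow φ g fun k g₀ _ => by rw [mul_comm, ← mul_assoc, mul_inv_cancel, one_mul]]

end CommTransfer

section Cores

variable {R : Type u} [Ring R] [TopologicalSpace R]
variable {G : Type v} [CommGroup G] [TopologicalSpace G] [IsTopologicalGroup G]
variable (X : TopRep.{v} R G) (H : Subgroup G) [Fintype (G ⧸ H)]

omit [IsTopologicalGroup G] [Fintype (G ⧸ H)] in
/-- **`g ↦ f(g ^ n)` is a continuous `1`-cocycle of `G`** for a continuous `1`-cocycle `f` of the
subgroup `H ∋ gⁿ` (`n = (G : H)`) and trivial coefficients. [cite: SerreLocalFields1979, VII §8] -/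
theorem exists_contOneCocycles_apply_eq_apply_pow [ContinuousMul G] [H.FiniteIndex]
    (htriv : ∀ (g : G) (v : X), X.ρ g v = v) (f : contOneCocycles (subgroupRep X H)) :
    ∃ ψ : contOneCocycles X, ∀ g : G, ψ.1 g = f.1 ⟨g ^ H.index, H.pow_index_mem g⟩ := by
  refine ⟨⟨⟨fun g => f.1 ⟨g ^ H.index, H.pow_index_mem g⟩,
    f.1.continuous.comp ((continuous_pow H.index).subtype_mk _)⟩, fun a b => ?_⟩, fun g => rfl⟩
  change f.1 ⟨(a * b) ^ H.index, _⟩ = f.1 ⟨a ^ H.index, _⟩ + X.ρ a (f.1 ⟨b ^ H.index, _⟩)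
  rw [htriv]
  have hmul : (⟨(a * b) ^ H.index, H.pow_index_mem (a * b)⟩ : H) =
      ⟨a ^ H.index, H.pow_index_mem a⟩ * ⟨b ^ H.index, H.pow_index_mem b⟩ :=
    Subtype.ext (mul_pow a b H.index)
  rw [hmul, subgroup_cocycle_mul, htriv]

/-- **`cor [f] = [g ↦ f(g ^ (G : H))]` in `H¹(G, X)` for `G` commutative with trivial coefficients**:
the corestriction along the open finite-index subgroup `H` of the class of a continuous character
`f : H → X` is the class of (any continuous cocycle `ψ` with values) `g ↦ f(gⁿ)`, `n = (G : H)`.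
[cite: SerreLocalFields1979, VII §8] -/
theorem cores_oneCocycleClass_eq_of_comm (htriv : ∀ (g : G) (v : X), X.ρ g v = v)
    (hH : IsOpen (H : Set G)) (f : contOneCocycles (subgroupRep X H)) (ψ : contOneCocycles X)
    (hψ : ∀ g : G, ψ.1 g = f.1 ⟨g ^ H.index, H.pow_index_mem g⟩) :
    cores X H hH (oneCocycleClass _ f) = oneCocycleClass X ψ := by
  haveI : H.FiniteIndex := Subgroup.finiteIndex_of_finite_quotient
  -- `f` as a homomorphism `H →* Multiplicative X`
  let φ : H →* Multiplicative X :=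
    { toFun := fun h => Multiplicative.ofAdd (f.1 h)
      map_one' := by rw [contOneCocycles.apply_one]; rfl
      map_mul' := fun a b => by rw [subgroup_cocycle_mul, htriv]; rfl }
  refine cores_oneCocycleClass_eq_of_trivial X H htriv hH f φ (fun _ => rfl) ψ fun g => ?_
  rw [hψ g, transfer_eq_apply_pow_index]
  rfl

end Cores

end Literature.NumberTheory.GaloisRepresentations

end
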